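import Summits.QuantumFields.BalabanUV.T4Continuum.Spine.NE3.QbarTowerB8
import Summits.QuantumFields.BalabanUV.T4Continuum.Support.NE3LinearNormalPartPreSizes
import Summits.QuantumFields.BalabanUV.T4Continuum.Support.ShellMeasureAverageLocality148
import HarnessLib

/-!
# T⁴ programme, node NE3 — REPAIR R24 (γ2): THE LOCAL QUADRATIC LETTER OF THE B8 DIRECTION — `‖QbarIter L k W Z (z, κ)‖ ≤ const(d)·e^{cα₀}·(L^k·m(z,κ))²`
# whenever `‖Z‖ ≤ m(z,κ)` on the block pair `B^k(c₋) ∪ B^k(c₊)` feeding the coarse bond `c = (z, κ)` — from (1.37) by TRUNCATION (locality of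
# [Balaban1985Averaging] (127) and of its linear part) and the tree's unconditional Proposition 4 applied to the truncated field

Cell `pub-balaban-gaps` (YM blitz, track G2, seat `ne3`, unit `pub-balaban-gaps-ne3`; writer prover-pub-balaban-gaps-ne3-g3-0, 2026-08-22), census
`run/shared/lean/pub/pub-balaban-gaps/ne/NE3.md` §4 R24 (γ).  Inputs BY NAME (all landed): gen 2's Π-C identity on B8's surface
`Spine/NE3/QbarTowerB8.adField_QbarIter_eq_neg_remainder` (p343524 ✓: `adField (cavgIter L k W) (QbarIter L k W Z) = −(logCovIter − linCovIter) L W (adField W Z) k`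
under (1.37)), the substrate's LOCALITY of the two composites `ShellMeasureAverageLocality148.logCovIter_congr` ∕ `linCovIter_congr` ([Balaban1985Averaging] p. 24
«depends only on the bond variables U_b for b ⊂ B^k(c₋) ∪ B^k(c₊)», (127) and its linear part (122)), the truncation chart
`B7Prop5Flat.agreeOn_insCfg_restr` ∕ `bondsIn`, and the tree's UNCONDITIONAL [Balaban1985Averaging] Prop. 4 at a general background
`B7Eq123General.prop4_general` (the composite remainder is `≤ 8C₁e^{4cα₀}(L^k·sup‖B‖)²` for ANY field `B` of small sup — no constraint needed).

THE POINT (route Π's Π-C-3d `NE3QuadRemainderFibre.norm_dirIter_le_of_fibre_local`, now on B8's surface).  Gen 2's `norm_QbarIter_le` bounds the normal datum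
`φ := QbarIter L k W Z` of the chart supplier by the GLOBAL sup of `Z`; the ν-letter of the supplier (`NE3LinearNormalPartPreSizes.preSizes_of_letters`, generic in
`φ`) needs the LOCAL form `‖φ(z,κ)‖ ≤ C₂·(L^k·m(z,κ))²` against a local sup majorant `m`.  MECHANISM: the identity `Ad·φ = −Rem(A)`, `A = Ad_W Z`, holds for the TRUE
direction (it uses (1.37)); at the bond `c = (z,κ)` both composites read `A` only on the bonds of `B^k(c₋) ∪ B^k(c₊)`, so `Rem(A)(c) = Rem(A′)(c)`
for the truncated field `A′ := insCfg S (restr S A)`, `S = bondsIn (loK L k z) (bondHiK L k z κ)`, whose GLOBAL sup is the LOCAL sup of `Z`; Prop. 4's remainder bound for `A′` needs no constraint.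

CONTENT (0 sorry, no `def`):
§1 `norm_insCfg_restr_le` — the truncated field is bounded by the local bound;
§2 **`norm_adField_QbarIter_le_local`** ∕ **`norm_QbarIter_le_local`** — gen 2's `norm_adField_QbarIter_le` ∕ `norm_QbarIter_le` with the quadratic factor
   `(L^k·b)²` replaced by `(L^k·m)²`, `m ≤ b` any bound of `‖Z‖` on the block pair feeding `(z,κ)` (the global regime hypotheses in `b` are kept: they feed the
   exponential identification `dbavgCovIter_eq_expCfg_logCovIter` of the TRUE direction);
§3 **`norm_QbarIter_le_of_localSupMajorant`** — the `hφ`-input of `preSizes_of_letters` on B8's surface: for a (Π-REG) majorant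
   `NE3LinearNormalPartPreSizes.LocalSupMajorant L N k Z m C` with `m ≤ b`, `‖QbarIter L k W Z z κ‖ ≤ C₂·(L^k·m z κ)²` at EVERY coarse bond,
   `C₂ = 8·131072(d+1)²·e^{3200(d+1)²(d+4)α₀}`; and `landauRepB8Avg_norm_QbarIter_le_local` — the same read off the shape (b = s₁ξ, `L^k·b = s₁`).

HONEST FRAMING.  Kinematics of the lineage's formal objects plus the tree's [B7] Prop. 4 (not re-proved); the majorant is a HYPOTHESIS (Π-REG, regularity TYPE,
ours in form — NOT printed); nothing about Bałaban's minimisers is asserted; the chart supplier, (P♮), (RES♯), the covariant root and **NE3 are NOT proved**;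
spine PROVED 0∕9; finite T⁴ rung (B)+1 — NOT infinite volume, NOT mass gap, NOT `BetaPertH`, NOT Clay.  ABSOLUTE RULE kept (context only:
[Balaban1985Averaging] p. 24, (122) p. 36, (127)–(135) pp. 37–38; [Balaban1985RegularSpaces] (1.37) p. 82).  PLACEMENT:
`Summits/QuantumFields/BalabanUV/T4Continuum/Spine/NE3/`; imports accepted modules only; moves nothing.  HONEST DEPENDENCY: continuum YM on T⁴ ⇐ BetaPertH ∧ nine
spine estimates (0/9 proved); BetaPertH ⇐ (D1) ∧ (D4) ∧ CAP+tail; G-an2-4 gates asym, D1 and NE2/3/4.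
-/

set_option autoImplicit false

open scoped BigOperators Matrix Matrix.Norms.L2Operator
open NormedSpace Finset

namespace Summit.QuantumFields.BalabanUV.T4Continuum.NE3.QbarLocalB8

open Literature.MathematicalPhysics.QuantumFieldTheory.Balaban1983to89
open B7Prop1Explicit B7Prop2Explicit B7Prop3Flat MatrixLog
open B7Prop1Local (InBox AgreeOn loK bondHiK)
open B7Prop5Flat (BondIn bondsIn restr mem_bondsIn insCfg_restr_of_mem agreeOn_insCfg_restr)
open ShellMeasureAverageLocality148 (logCovIter_congr linCovIter_congr)
open T4AveragingDeficitWall (Ad IsUnitaryCfg)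
open T4AveragingDeficitWallBoundary (periodBox)
open AveragingDeficitTransport (norm_Ad_of_unitary)
open AveragingDeficitChartCalculus (cavg)
open AveragingDeficitMultiLevelPrep (cavgIter)
open AveragingDeficitMultiLevelBridge (cavgIter_eq_avgIter)
open NE3TangentCovariantTower (QbarIter)
open B7Eq92Concrete (dbavgCovIter)
open B7Prop3GeneralLinear (linQcov)
open B7Prop4GeneralLevels (logCovIter linCovIter linCovIter_succ)
open B7Eq123General (prop4_general level_data blockLoops_of_pdev)
open NE3.PairLandauB8Avg (relPert LandauRepB8Avg)
open NE3.QbarDictionary (adField relPert_eq_expCfg_adField)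
open NE3.QbarTowerB8 (adField_QbarIter_eq_neg_remainder)
open NE3LinearNormalPartPreSizes (LocalSupMajorant)

noncomputable section

variable {d : ℕ}

/-! ## §1 The truncated field is bounded by the local bound -/

section Composite

variable {𝔸 : Type*} [NormedRing 𝔸]

/-- **THE TRUNCATED FIELD**: if `‖A b‖ ≤ m` on the bonds of `S` and `0 ≤ m`, then `insCfg S (restr S A)` (the field `A` on `S`, zero elsewhere) is bounded
by `m` EVERYWHERE. [folklore] -/
theorem norm_insCfg_restr_le {S : Finset (Site d × Fin d)} {A : Site d → Fin d → 𝔸} {m : ℝ} (hm : 0 ≤ m)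
    (hA : ∀ s ∈ S, ‖A s.1 s.2‖ ≤ m) : ∀ (x : Site d) (κ : Fin d), ‖insCfg S (restr S A) x κ‖ ≤ m := by
  intro x κ
  by_cases h : (x, κ) ∈ S
  · rw [insCfg_restr_of_mem S A h]; exact hA (x, κ) h
  · have h0 : insCfg S (restr S A) x κ = 0 := by simp [insCfg, h]
    rw [h0, norm_zero]; exact hm

end Composite

/-! ## §2 The local quadratic letter of the B8 direction -/

variable {n : Type*} [Fintype n] [DecidableEq n]

/-- **THE LOCAL QUADRATIC LETTER ON B8's SURFACE** (unitary background `W`, `L ≥ 2`, level `k = j+1`): in the regime of gen 2's `norm_adField_QbarIter_le`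
(`pdev W < α₀·((L^{j+1})⁻¹)²`, `C0·α₀ ≤ 1∕3`, `4α₀ ≤ c2′`, GLOBAL `sup‖Z‖ ≤ b` with `e^{3200(d+1)²(d+4)α₀}(1 + 8·131072(d+1)²·L^{j+1}b) ≤ 2`, `2L^{j+1}b ≤ c3`,
and (1.37) `dbavgCovIter L W (expCfg (adField W Z)) (j+1) = 1`), if moreover `‖Z x μ‖ ≤ m ≤ b` for every bond `(x, μ)` of the block pair
`B^{j+1}(c₋) ∪ B^{j+1}(c₊)` feeding the coarse bond `c = (z, κ)` (the box `loK`∕`bondHiK` of record), then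
`‖adField (cavgIter L (j+1) W) (QbarIter L (j+1) W Z) (z, κ)‖ ≤ 8·131072(d+1)²·e^{3200(d+1)²(d+4)α₀}·(L^{j+1}·m)²` — the quadratic factor is LOCAL.
Truncation: the remainder of the TRUE field at `c` equals that of `insCfg S (restr S (adField W Z))`, `S = bondsIn (loK L (j+1) z) (bondHiK L (j+1) z κ)` (`logCovIter_congr`, `linCovIter_congr`),
and [Balaban1985Averaging] Prop. 4 bounds the latter's remainder by its GLOBAL sup `m` with no constraint. [folklore] -/
theorem norm_adField_QbarIter_le_local [Nonempty n] (L : ℕ) (hL : 2 ≤ L) (W : Site d → Fin d → (Matrix n n ℂ)ˣ) (hWu : IsUnitaryCfg W)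
    (Z : Site d → Fin d → Matrix n n ℂ) (j : ℕ) {α₀ b : ℝ} (hα : 0 < α₀) (hα3 : C0 d * α₀ ≤ 1 / 3) (hα4 : 4 * α₀ ≤ c2' d L)
    (h52 : pdev W < α₀ * (((L : ℝ) ^ (j + 1))⁻¹) ^ 2) (hb : 0 ≤ b) (hZ : ∀ (x : Site d) (κ : Fin d), ‖Z x κ‖ ≤ b)
    (hsmall : Real.exp (4 * (800 * ((d : ℝ) + 1) ^ 2 * ((d : ℝ) + 4)) * α₀)
      * (1 + 8 * (131072 * ((d : ℝ) + 1) ^ 2) * ((L : ℝ) ^ (j + 1) * b)) ≤ 2)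
    (hc₃ : 2 * ((L : ℝ) ^ (j + 1) * b) ≤ c3 d L)
    (hdbar : dbavgCovIter L W (expCfg (adField W Z)) (j + 1) = 1)
    (z : Site d) (κ : Fin d) {m : ℝ} (hm : 0 ≤ m) (hmb : m ≤ b)
    (hZloc : ∀ (x : Site d) (μ : Fin d), InBox (loK L (j + 1) z) (bondHiK L (j + 1) z κ) x →
      InBox (loK L (j + 1) z) (bondHiK L (j + 1) z κ) (x + e μ) → ‖Z x μ‖ ≤ m) :
    ‖adField (cavgIter L (j + 1) W) (QbarIter L (j + 1) W Z) z κ‖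
      ≤ 8 * (131072 * ((d : ℝ) + 1) ^ 2) * Real.exp (4 * (800 * ((d : ℝ) + 1) ^ 2 * ((d : ℝ) + 4)) * α₀)
          * ((L : ℝ) ^ (j + 1) * m) ^ 2 := by
  letI : CStarAlgebra (Matrix n n ℂ) := {}
  have hG := avgClosed_unitaryUnits d (𝔸 := Matrix n n ℂ) L
  have hU₀ : ∀ (x : Site d) (κ : Fin d), W x κ ∈ unitaryUnits (Matrix n n ℂ) := hWu
  have hL1 : 1 ≤ L := by omega
  have hB : ∀ (x : Site d) (κ : Fin d), ‖adField W Z x κ‖ ≤ b := fun x κ => by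
    unfold adField
    rw [norm_Ad_of_unitary (hWu x κ)]
    exact hZ x κ
  -- (1) the Π-C identity for the TRUE direction (global regime)
  have hQ := B7Eq123General.dbavgCovIter_eq_expCfg_logCovIter L hL hG (j + 1) W hU₀ hα hα3 hα4 h52 (adField W Z) hb hB hsmall hc₃
  have hld := level_data L hL hG (j + 1) W hU₀ hα hα3 hα4 h52
  have hW : ∀ i < j + 1, ∀ (z : Site d) (κ : Fin d) (r : Fin d → Fin L),
      ‖((Wcx L (cavgIter L i W) ((L : ℤ) • z) κ (boxVec L r) : (Matrix n n ℂ)ˣ) : Matrix n n ℂ) - 1‖ < 1 := by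
    intro i hi z κ r
    obtain ⟨hV, hβ0, hβ, hβmax⟩ := hld i hi.le
    rw [cavgIter_eq_avgIter]
    have h := blockLoops_of_pdev hL1 hV hβ0 hβ hβmax ((L : ℤ) • z) κ
    exact ((h.1 r).trans h.2).trans_lt (by norm_num)
  have hid := adField_QbarIter_eq_neg_remainder L W Z j (hQ j (Nat.le_succ j)) hdbar hW
  -- (2) truncation to the block pair feeding `(z, κ)`
  set S : Finset (Site d × Fin d) := bondsIn (loK L (j + 1) z) (bondHiK L (j + 1) z κ) with hSdef
  set A' : Site d → Fin d → Matrix n n ℂ := insCfg S (restr S (adField W Z)) with hA'def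
  have hagree : AgreeOn (loK L (j + 1) z) (bondHiK L (j + 1) z κ) (adField W Z) A' :=
    agreeOn_insCfg_restr (loK L (j + 1) z) (bondHiK L (j + 1) z κ) (adField W Z)
  have hlog : logCovIter L W (adField W Z) (j + 1) z κ = logCovIter L W A' (j + 1) z κ :=
    logCovIter_congr L hL1 (j + 1) z κ (fun _ _ _ _ => rfl) hagree
  have hlin : linCovIter L W (adField W Z) (j + 1) z κ = linCovIter L W A' (j + 1) z κ :=
    linCovIter_congr L hL1 (j + 1) z κ (fun _ _ _ _ => rfl) hagree
  -- (3) the truncated field has GLOBAL sup `m`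
  have hB' : ∀ (x : Site d) (κ' : Fin d), ‖A' x κ'‖ ≤ m := by
    refine norm_insCfg_restr_le hm fun s hs => ?_
    have hs' : BondIn (loK L (j + 1) z) (bondHiK L (j + 1) z κ) s.1 s.2 := mem_bondsIn.mp hs
    unfold adField
    rw [norm_Ad_of_unitary (hWu s.1 s.2)]
    exact hZloc s.1 s.2 hs'.1 hs'.2
  -- (4) Prop. 4 for the truncated field, in the (weaker) regime of `m ≤ b`
  have hLm : (L : ℝ) ^ (j + 1) * m ≤ (L : ℝ) ^ (j + 1) * b := mul_le_mul_of_nonneg_left hmb (by positivity)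
  have hexp0 : 0 ≤ Real.exp (4 * (800 * ((d : ℝ) + 1) ^ 2 * ((d : ℝ) + 4)) * α₀) := (Real.exp_pos _).le
  have hsmall' : Real.exp (4 * (800 * ((d : ℝ) + 1) ^ 2 * ((d : ℝ) + 4)) * α₀)
      * (1 + 8 * (131072 * ((d : ℝ) + 1) ^ 2) * ((L : ℝ) ^ (j + 1) * m)) ≤ 2 := by
    have h1 : 1 + 8 * (131072 * ((d : ℝ) + 1) ^ 2) * ((L : ℝ) ^ (j + 1) * m)
        ≤ 1 + 8 * (131072 * ((d : ℝ) + 1) ^ 2) * ((L : ℝ) ^ (j + 1) * b) := by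
      have := mul_le_mul_of_nonneg_left hLm (by positivity : (0:ℝ) ≤ 8 * (131072 * ((d : ℝ) + 1) ^ 2))
      linarith
    exact (mul_le_mul_of_nonneg_left h1 hexp0).trans hsmall
  have hc₃' : 2 * ((L : ℝ) ^ (j + 1) * m) ≤ c3 d L := by linarith
  have h4 := prop4_general L hL hG (j + 1) W hU₀ hα hα3 hα4 h52 A' hm hB' hsmall' hc₃'
  have hb4 := (h4 (j + 1) le_rfl).1 z κ
  rw [hid]
  simp only [Pi.neg_apply, Pi.sub_apply, norm_neg]
  rw [hlog, hlin]
  exact hb4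

/-- **THE SAME FOR `QbarIter` ITSELF** when the level-`(j+1)` averaged background is unitary (`Ad` by a unitary is an isometry). [folklore] -/
theorem norm_QbarIter_le_local [Nonempty n] (L : ℕ) (hL : 2 ≤ L) (W : Site d → Fin d → (Matrix n n ℂ)ˣ) (hWu : IsUnitaryCfg W)
    (hWk : ∀ (j : ℕ), IsUnitaryCfg (cavgIter L j W))
    (Z : Site d → Fin d → Matrix n n ℂ) (j : ℕ) {α₀ b : ℝ} (hα : 0 < α₀) (hα3 : C0 d * α₀ ≤ 1 / 3) (hα4 : 4 * α₀ ≤ c2' d L)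
    (h52 : pdev W < α₀ * (((L : ℝ) ^ (j + 1))⁻¹) ^ 2) (hb : 0 ≤ b) (hZ : ∀ (x : Site d) (κ : Fin d), ‖Z x κ‖ ≤ b)
    (hsmall : Real.exp (4 * (800 * ((d : ℝ) + 1) ^ 2 * ((d : ℝ) + 4)) * α₀)
      * (1 + 8 * (131072 * ((d : ℝ) + 1) ^ 2) * ((L : ℝ) ^ (j + 1) * b)) ≤ 2)
    (hc₃ : 2 * ((L : ℝ) ^ (j + 1) * b) ≤ c3 d L)
    (hdbar : dbavgCovIter L W (expCfg (adField W Z)) (j + 1) = 1)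
    (z : Site d) (κ : Fin d) {m : ℝ} (hm : 0 ≤ m) (hmb : m ≤ b)
    (hZloc : ∀ (x : Site d) (μ : Fin d), InBox (loK L (j + 1) z) (bondHiK L (j + 1) z κ) x →
      InBox (loK L (j + 1) z) (bondHiK L (j + 1) z κ) (x + e μ) → ‖Z x μ‖ ≤ m) :
    ‖QbarIter L (j + 1) W Z z κ‖
      ≤ 8 * (131072 * ((d : ℝ) + 1) ^ 2) * Real.exp (4 * (800 * ((d : ℝ) + 1) ^ 2 * ((d : ℝ) + 4)) * α₀)
          * ((L : ℝ) ^ (j + 1) * m) ^ 2 := by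
  have h := norm_adField_QbarIter_le_local L hL W hWu Z j hα hα3 hα4 h52 hb hZ hsmall hc₃ hdbar z κ hm hmb hZloc
  unfold adField at h
  rwa [norm_Ad_of_unitary (hWk (j + 1) z κ)] at h

/-! ## §3 The `hφ`-input of the pre-sizes from a (Π-REG) majorant -/

/-- **THE LOCAL QUADRATIC LETTER FROM A SQUARE-SUMMABLE LOCAL SUP MAJORANT** (the `hφ`-hypothesis of `NE3LinearNormalPartPreSizes.preSizes_of_letters` with
`φ := QbarIter L (j+1) W Z`, on B8's surface): in the regime of `norm_QbarIter_le_local`, a majorant `LocalSupMajorant L N (j+1) Z m C` with `m z κ ≤ b` gives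
`‖QbarIter L (j+1) W Z z κ‖ ≤ C₂·(L^{j+1}·m z κ)²` at EVERY coarse bond, `C₂ = 8·131072(d+1)²·e^{3200(d+1)²(d+4)α₀}` (k-FREE).  The majorant is a HYPOTHESIS
(Π-REG — [Balaban1985Variational] Thm 1∕Prop 2 regularity TYPE for the relative field of the pair; ours in form, NOT printed). [folklore] -/
theorem norm_QbarIter_le_of_localSupMajorant [Nonempty n] (L : ℕ) (hL : 2 ≤ L) {N : ℕ} (W : Site d → Fin d → (Matrix n n ℂ)ˣ)
    (hWu : IsUnitaryCfg W) (hWk : ∀ (j : ℕ), IsUnitaryCfg (cavgIter L j W))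
    (Z : Site d → Fin d → Matrix n n ℂ) (j : ℕ) {α₀ b : ℝ} (hα : 0 < α₀) (hα3 : C0 d * α₀ ≤ 1 / 3) (hα4 : 4 * α₀ ≤ c2' d L)
    (h52 : pdev W < α₀ * (((L : ℝ) ^ (j + 1))⁻¹) ^ 2) (hb : 0 ≤ b) (hZ : ∀ (x : Site d) (κ : Fin d), ‖Z x κ‖ ≤ b)
    (hsmall : Real.exp (4 * (800 * ((d : ℝ) + 1) ^ 2 * ((d : ℝ) + 4)) * α₀)
      * (1 + 8 * (131072 * ((d : ℝ) + 1) ^ 2) * ((L : ℝ) ^ (j + 1) * b)) ≤ 2)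
    (hc₃ : 2 * ((L : ℝ) ^ (j + 1) * b) ≤ c3 d L)
    (hdbar : dbavgCovIter L W (expCfg (adField W Z)) (j + 1) = 1)
    {m : Site d → Fin d → ℝ} {C : ℝ} (hmaj : LocalSupMajorant L N (j + 1) Z m C) (hmb : ∀ (z : Site d) (κ : Fin d), m z κ ≤ b) :
    ∀ (z : Site d) (κ : Fin d), ‖QbarIter L (j + 1) W Z z κ‖
      ≤ (8 * (131072 * ((d : ℝ) + 1) ^ 2) * Real.exp (4 * (800 * ((d : ℝ) + 1) ^ 2 * ((d : ℝ) + 4)) * α₀))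
          * ((L : ℝ) ^ (j + 1) * m z κ) ^ 2 :=
  fun z κ => norm_QbarIter_le_local L hL W hWu hWk Z j hα hα3 hα4 h52 hb hZ hsmall hc₃ hdbar z κ (hmaj.nonneg z κ) (hmb z κ)
    (hmaj.dom z κ)

/-- **THE SAME READ OFF THE SHAPE `LandauRepB8Avg`** (level `k = j+1`, `ξ = (L⁻¹)^{j+1}`, so `L^{j+1}·(s₁ξ) = s₁`): (1.37) is the shape's `dbar`, the global sup is
(1.36) `‖Z‖ ≤ s₁ξ`, the regime lines read `e^{3200(d+1)²(d+4)α₀}(1 + 8·131072(d+1)²·s₁) ≤ 2`, `2s₁ ≤ c3`; for a (Π-REG) majorant with `m ≤ s₁ξ` the normal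
datum obeys `‖QbarIter L (j+1) W Z z κ‖ ≤ C₂·(L^{j+1}·m z κ)²`, `C₂` k-FREE. [folklore] -/
theorem landauRepB8Avg_norm_QbarIter_le_local [Nonempty n] {L N j : ℕ} (hL : 2 ≤ L)
    {W UA : Site d → Fin d → (Matrix n n ℂ)ˣ} {u : Site d → (Matrix n n ℂ)ˣ} {Z : Site d → Fin d → Matrix n n ℂ} {s₁ s₂ β : ℝ}
    (h : LandauRepB8Avg L N (j + 1) W UA u Z s₁ s₂ β) (hWu : IsUnitaryCfg W) (hWk : ∀ (i : ℕ), IsUnitaryCfg (cavgIter L i W))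
    {α₀ : ℝ} (hα : 0 < α₀) (hα3 : C0 d * α₀ ≤ 1 / 3) (hα4 : 4 * α₀ ≤ c2' d L)
    (h52 : pdev W < α₀ * (((L : ℝ) ^ (j + 1))⁻¹) ^ 2) (hs₁ : 0 ≤ s₁)
    (hsmall : Real.exp (4 * (800 * ((d : ℝ) + 1) ^ 2 * ((d : ℝ) + 4)) * α₀) * (1 + 8 * (131072 * ((d : ℝ) + 1) ^ 2) * s₁) ≤ 2)
    (hc₃ : 2 * s₁ ≤ c3 d L)
    {m : Site d → Fin d → ℝ} {C : ℝ} (hmaj : LocalSupMajorant L N (j + 1) Z m C)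
    (hmb : ∀ (z : Site d) (κ : Fin d), m z κ ≤ s₁ * ((L : ℝ)⁻¹) ^ (j + 1)) :
    ∀ (z : Site d) (κ : Fin d), ‖QbarIter L (j + 1) W Z z κ‖
      ≤ (8 * (131072 * ((d : ℝ) + 1) ^ 2) * Real.exp (4 * (800 * ((d : ℝ) + 1) ^ 2 * ((d : ℝ) + 4)) * α₀))
          * ((L : ℝ) ^ (j + 1) * m z κ) ^ 2 := by
  have hL0 : (0 : ℝ) < L := by exact_mod_cast (show 0 < L by omega)
  have hξ : (L : ℝ) ^ (j + 1) * (s₁ * ((L : ℝ)⁻¹) ^ (j + 1)) = s₁ := by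
    rw [inv_pow, mul_comm s₁, ← mul_assoc, mul_inv_cancel₀ (pow_ne_zero _ hL0.ne'), one_mul]
  have hb : 0 ≤ s₁ * ((L : ℝ)⁻¹) ^ (j + 1) := mul_nonneg hs₁ (pow_nonneg (inv_nonneg.mpr hL0.le) _)
  have hdbar : dbavgCovIter L W (expCfg (adField W Z)) (j + 1) = 1 := by
    rw [← relPert_eq_expCfg_adField]; exact h.dbar
  refine norm_QbarIter_le_of_localSupMajorant L hL W hWu hWk Z j hα hα3 hα4 h52 hb h.sup ?_ ?_ hdbar hmaj hmb
  · rw [hξ]; exact hsmall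
  · rw [hξ]; exact hc₃

/-! ## §4 The same with the unitarity of the LEVEL-`(j+1)` averaged background only (the class supplies it: `cavgIter_unitary_small`) -/

/-- **`norm_QbarIter_le_local` WITH UNITARITY AT LEVEL `j+1` ONLY**: the proof of `norm_QbarIter_le_local` uses `hWk` at the single level `j+1`; in the multi-level
small-field class that unitarity is a theorem (`NE3QbarIterCovLiftPrep`∕`AveragingDeficitMultiLevelPrep.cavgIter_unitary_small`), whereas unitarity at EVERY level is not
available from the class. [folklore] -/
theorem norm_QbarIter_le_local₁ [Nonempty n] (L : ℕ) (hL : 2 ≤ L) (W : Site d → Fin d → (Matrix n n ℂ)ˣ) (hWu : IsUnitaryCfg W) (j : ℕ)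
    (hWk : IsUnitaryCfg (cavgIter L (j + 1) W))
    (Z : Site d → Fin d → Matrix n n ℂ) {α₀ b : ℝ} (hα : 0 < α₀) (hα3 : C0 d * α₀ ≤ 1 / 3) (hα4 : 4 * α₀ ≤ c2' d L)
    (h52 : pdev W < α₀ * (((L : ℝ) ^ (j + 1))⁻¹) ^ 2) (hb : 0 ≤ b) (hZ : ∀ (x : Site d) (κ : Fin d), ‖Z x κ‖ ≤ b)
    (hsmall : Real.exp (4 * (800 * ((d : ℝ) + 1) ^ 2 * ((d : ℝ) + 4)) * α₀)
      * (1 + 8 * (131072 * ((d : ℝ) + 1) ^ 2) * ((L : ℝ) ^ (j + 1) * b)) ≤ 2)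
    (hc₃ : 2 * ((L : ℝ) ^ (j + 1) * b) ≤ c3 d L)
    (hdbar : dbavgCovIter L W (expCfg (adField W Z)) (j + 1) = 1)
    (z : Site d) (κ : Fin d) {m : ℝ} (hm : 0 ≤ m) (hmb : m ≤ b)
    (hZloc : ∀ (x : Site d) (μ : Fin d), InBox (loK L (j + 1) z) (bondHiK L (j + 1) z κ) x →
      InBox (loK L (j + 1) z) (bondHiK L (j + 1) z κ) (x + e μ) → ‖Z x μ‖ ≤ m) :
    ‖QbarIter L (j + 1) W Z z κ‖
      ≤ 8 * (131072 * ((d : ℝ) + 1) ^ 2) * Real.exp (4 * (800 * ((d : ℝ) + 1) ^ 2 * ((d : ℝ) + 4)) * α₀)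
          * ((L : ℝ) ^ (j + 1) * m) ^ 2 := by
  have h := norm_adField_QbarIter_le_local L hL W hWu Z j hα hα3 hα4 h52 hb hZ hsmall hc₃ hdbar z κ hm hmb hZloc
  unfold adField at h
  rwa [norm_Ad_of_unitary (hWk z κ)] at h

/-- **The `hφ`-input from a (Π-REG) majorant, with unitarity at level `j+1` only.** [folklore] -/
theorem norm_QbarIter_le_of_localSupMajorant₁ [Nonempty n] (L : ℕ) (hL : 2 ≤ L) {N : ℕ} (W : Site d → Fin d → (Matrix n n ℂ)ˣ)
    (hWu : IsUnitaryCfg W) (j : ℕ) (hWk : IsUnitaryCfg (cavgIter L (j + 1) W))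
    (Z : Site d → Fin d → Matrix n n ℂ) {α₀ b : ℝ} (hα : 0 < α₀) (hα3 : C0 d * α₀ ≤ 1 / 3) (hα4 : 4 * α₀ ≤ c2' d L)
    (h52 : pdev W < α₀ * (((L : ℝ) ^ (j + 1))⁻¹) ^ 2) (hb : 0 ≤ b) (hZ : ∀ (x : Site d) (κ : Fin d), ‖Z x κ‖ ≤ b)
    (hsmall : Real.exp (4 * (800 * ((d : ℝ) + 1) ^ 2 * ((d : ℝ) + 4)) * α₀)
      * (1 + 8 * (131072 * ((d : ℝ) + 1) ^ 2) * ((L : ℝ) ^ (j + 1) * b)) ≤ 2)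
    (hc₃ : 2 * ((L : ℝ) ^ (j + 1) * b) ≤ c3 d L)
    (hdbar : dbavgCovIter L W (expCfg (adField W Z)) (j + 1) = 1)
    {m : Site d → Fin d → ℝ} {C : ℝ} (hmaj : LocalSupMajorant L N (j + 1) Z m C) (hmb : ∀ (z : Site d) (κ : Fin d), m z κ ≤ b) :
    ∀ (z : Site d) (κ : Fin d), ‖QbarIter L (j + 1) W Z z κ‖
      ≤ (8 * (131072 * ((d : ℝ) + 1) ^ 2) * Real.exp (4 * (800 * ((d : ℝ) + 1) ^ 2 * ((d : ℝ) + 4)) * α₀))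
          * ((L : ℝ) ^ (j + 1) * m z κ) ^ 2 :=
  fun z κ => norm_QbarIter_le_local₁ L hL W hWu j hWk Z hα hα3 hα4 h52 hb hZ hsmall hc₃ hdbar z κ (hmaj.nonneg z κ) (hmb z κ)
    (hmaj.dom z κ)

/-- **The same read off `LandauRepB8Avg`, with unitarity at level `j+1` only.** [folklore] -/
theorem landauRepB8Avg_norm_QbarIter_le_local₁ [Nonempty n] {L N j : ℕ} (hL : 2 ≤ L)
    {W UA : Site d → Fin d → (Matrix n n ℂ)ˣ} {u : Site d → (Matrix n n ℂ)ˣ} {Z : Site d → Fin d → Matrix n n ℂ} {s₁ s₂ β : ℝ}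
    (h : LandauRepB8Avg L N (j + 1) W UA u Z s₁ s₂ β) (hWu : IsUnitaryCfg W) (hWk : IsUnitaryCfg (cavgIter L (j + 1) W))
    {α₀ : ℝ} (hα : 0 < α₀) (hα3 : C0 d * α₀ ≤ 1 / 3) (hα4 : 4 * α₀ ≤ c2' d L)
    (h52 : pdev W < α₀ * (((L : ℝ) ^ (j + 1))⁻¹) ^ 2) (hs₁ : 0 ≤ s₁)
    (hsmall : Real.exp (4 * (800 * ((d : ℝ) + 1) ^ 2 * ((d : ℝ) + 4)) * α₀) * (1 + 8 * (131072 * ((d : ℝ) + 1) ^ 2) * s₁) ≤ 2)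
    (hc₃ : 2 * s₁ ≤ c3 d L)
    {m : Site d → Fin d → ℝ} {C : ℝ} (hmaj : LocalSupMajorant L N (j + 1) Z m C)
    (hmb : ∀ (z : Site d) (κ : Fin d), m z κ ≤ s₁ * ((L : ℝ)⁻¹) ^ (j + 1)) :
    ∀ (z : Site d) (κ : Fin d), ‖QbarIter L (j + 1) W Z z κ‖
      ≤ (8 * (131072 * ((d : ℝ) + 1) ^ 2) * Real.exp (4 * (800 * ((d : ℝ) + 1) ^ 2 * ((d : ℝ) + 4)) * α₀))
          * ((L : ℝ) ^ (j + 1) * m z κ) ^ 2 := by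
  have hL0 : (0 : ℝ) < L := by exact_mod_cast (show 0 < L by omega)
  have hξ : (L : ℝ) ^ (j + 1) * (s₁ * ((L : ℝ)⁻¹) ^ (j + 1)) = s₁ := by
    rw [inv_pow, mul_comm s₁, ← mul_assoc, mul_inv_cancel₀ (pow_ne_zero _ hL0.ne'), one_mul]
  have hb : 0 ≤ s₁ * ((L : ℝ)⁻¹) ^ (j + 1) := mul_nonneg hs₁ (pow_nonneg (inv_nonneg.mpr hL0.le) _)
  have hdbar : dbavgCovIter L W (expCfg (adField W Z)) (j + 1) = 1 := by
    rw [← relPert_eq_expCfg_adField]; exact h.dbar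
  refine norm_QbarIter_le_of_localSupMajorant₁ L hL W hWu j hWk Z hα hα3 hα4 h52 hb h.sup ?_ ?_ hdbar hmaj hmb
  · rw [hξ]; exact hsmall
  · rw [hξ]; exact hc₃

end

end Summit.QuantumFields.BalabanUV.T4Continuum.NE3.QbarLocalB8
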